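import Mathlib
import HarnessLib
import Summits.HubbardSuperconductivity.HubbardSuperconductivity.Theorems.KLProgrammeKLRegimeSplitBundleV9

/-!
# Route `KLProgramme` — crux K3 `KLRegimeTwoPointLimit` (stmt-HubbardSuperconductivity-19937): the bundle
# `klPredsV10 := { FrameOK, RenormalisedAtF, BetaSplitAtS2, EngineBoundsAtV7S, TwoLegStepV10 }` — V9 (Δ16 count repair, Δ18 angular clause) with the
# ULTRAVIOLET twin of Δ16 repaired in the engine slot's two scale-`0` clauses (defect «Δ-UV», tribunal seat T2-2, INBOX 2026-08-26T17:32:54Z;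
# confirmed p1 g6 STATUS 17:49:53Z; count token corrected and typed by hubbard-kl-k3c2-p3)

Δ-UV.  At scale `0` the carrier is `effAction ℂ C^K_{>Λ₀} V_K` with `V_K = hubbardInteraction + counterQuadratic K`: the frame `K` IS a quadratic
VERTEX of the ultraviolet integration, and `C^K_{>Λ₀}(ω₀, k)` has weight `χ₂((ω₀² + e_K²)/Λ₀²) = 1` on the rim `|e_K| = Λ₀ = e₀` of the ball
`klBall = klShell … 0` (and on every leg outside the ball, e.g. the fourth leg `k₁ − k₂ + k₃`).  The first-order external-leg dressing
`U·C^K_{>Λ₀}(ℓ)·(K(ℓ) + Σ^{UV}(ℓ))` therefore moves the scale-`0` pair amplitude / `↑↓` value on rim legs by `≈ 64·(16/15)·Gfr₀·U²`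
(`FrameOK`'s `(j,n) = (0,0)` radius `R.Gfr 0·|U|`; the history `HistP … 0` is vacuous), an `R`-LINEAR QUADRATIC term, while the born tolerances
`initDevBar G U` ((E2-v6) at `n = 0`) and `|U| + initDevBar G U` ((E2′-S UV) `QuarticValueUVAtS`) are `G`-level: not certifiable for every `R`
(order `∃G ∀P ∀R ∃Q`).  REPAIR (T2-2 / p1 g6, count token corrected): charge the `Q`-level leg majorant ONCE at scale `0` for ALL FOUR legs —
`legDressBarQ G P Q U 0 4 = 4·Q.CR·((Klam U)² + (Klam|U|)³)` (`Q` after `R` absorbs `64·(16/15)·Gfr₀ + 4·cr + τ`).  Why NOT `legSliceCountT … 0`: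
its window's upper bound is `klScale klE0 (0 − 2) = Λ₀` (`ℕ`-subtraction), which EXCLUDES the rim (`t = √(ω₀² + Λ₀²) > Λ₀`) and every
outer leg — at scale `0` the «slice» is the whole ultraviolet covariance, unbounded in `t`, so no `Λ₀`-window is right; the constant `4` is
(`legSliceCountT_le_four`'s bound, and p1's / k3c1-p2's child-1 budget `X₀ ≤ 4·Q.CR·(Klam²U² + Klam³|U|³)` verbatim).

THE BUNDLE: `PairLadderStepAtV7` := (E2-v6) with the `n = 0` tolerance `initDevBar G U + legDressBarQ G P Q U 0 4`; `QuarticValueUVAtS2 G P Q …` :=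
(E2′-S UV) with `|U| + initDevBar G U + legDressBarQ G P Q U 0 4`; `EngineBoundsAtV7S` := `EngineBoundsAtV6S` with those two swapped (conjunct order
kept); `histV10 := BetaSplitAtS2 ∧ RenormalisedAtF ∧ EngineBoundsAtV7S`; `TwoLegStepV10 := TwoLegStepG histV10 ∧ TwoLegAngularG ∧ TwoLegVolumeRate
(histV10 ∧ TwoLegStepG histV10 ∧ TwoLegAngularG)` (V9's shape on the new history); `klPredsV10`; slot `rfl` lemmas; bridges; and the scale-`0`
comparison, now ONE-WAY: `EngineBoundsAtV6S … 0 → EngineBoundsAtV7S … 0` (the tolerances only grow; `engineBoundsAtV7S_zero_of_V6S`) — the born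
`Iff` of BundleV8 §4 is dropped.  The `1 ≤ n` clauses, the split / renorm / frame slots and (E3g) are V9's VERBATIM.  Definitions (+ bookkeeping)
only; nothing is asserted about the model.
-/

noncomputable section

namespace Summit.HubbardSuperconductivity.HubbardSuperconductivity.Theorems.KLRegimeSplit

set_option linter.dupNamespace false -- summit = problem name (single-conjunct summit), D-0017

open Real Finset Literature.MathematicalPhysics.QuantumLattice Literature.Probability.LatticeModels
open Summit.HubbardSuperconductivity.HubbardSuperconductivity.Theorems.KLProgrammeLegKernels

/-! ## §1 The two scale-`0` clauses, repaired -/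

section Model

variable (L M : ℕ) [NeZero L] [NeZero M]

/-- **(E2-v7) one pair-ladder step per scale** — `PairLadderStepAtV6` with the scale-`0` tolerance enlarged by the four-leg ultraviolet
dressing majorant `legDressBarQ G P Q U 0 4` (Δ-UV); the `1 ≤ n` conjunct is V6's verbatim. -/
def PairLadderStepAtV7 (G : GeoConsts) (P : SplitConsts) (Q : EngConsts) (β U μ : ℝ) (K : TrigPolyC4v) (n : ℕ) : Prop :=
  (n = 0 → ∀ Qm : TorusSite 2 L, ∀ k ∈ klBall L μ K, ∀ k' ∈ klBall L μ K,
      ‖klPairAmplitude L M β U μ K 0 Qm k k' - (U : ℂ)‖ ≤ initDevBar G U + legDressBarQ G P Q U 0 4) ∧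
  (1 ≤ n → ∀ Qm : TorusSite 2 L, IsPairClassAt L Qm n →
      ∃ w : TorusSite 2 L → ℝ, (∀ p, 0 ≤ w p) ∧ (∑ p, w p ≤ G.bhi) ∧
        ∃ N : Matrix (TorusSite 2 L) (TorusSite 2 L) ℂ,
          (1 + Matrix.diagonal (fun p => (w p : ℂ)) * klPairArray L M β U μ K (n - 1) Qm) * N = 1 ∧
          ∀ k ∈ klBall L μ K, ∀ k' ∈ klBall L μ K,
            ‖klPairAmplitude L M β U μ K n Qm k k' - (klPairArray L M β U μ K (n - 1) Qm * N) k k'‖ ≤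
              drivePBar G P U (n - 1) + eremBar G P Q U β L (n - 1) + thermalBar G P U β n +
                legDressBarQ G P Q U n (legSliceCountT L β μ K n ![k', Qm - k', Qm - k, k]))

/-- **(E2′-S2 UV) the ultraviolet size of the `↑↓` running coupling values** — `QuarticValueUVAtS` with the four-leg ultraviolet dressing
majorant added: `|λ₀^{↑↓}(k₁,k₂,k₃)| ≤ |U| + initDevBar G U + legDressBarQ G P Q U 0 4` on the ball (Δ-UV; now reads `P`, `Q`). -/
def QuarticValueUVAtS2 (G : GeoConsts) (P : SplitConsts) (Q : EngConsts) (β U μ : ℝ) (K : TrigPolyC4v) (n : ℕ) : Prop :=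
  n = 0 → ∀ k₁ ∈ klBall L μ K, ∀ k₂ ∈ klBall L μ K, ∀ k₃ ∈ klBall L μ K,
    ‖klQuarticValue L M β U μ K 0 0 1 k₁ k₂ k₃‖ ≤ |U| + initDevBar G U + legDressBarQ G P Q U 0 4

/-- **`EngineBoundsAtV7S … G P Q K n`** = `EngineBoundsAtV6S` with (E2-v6) ↦ (E2-v7) and (E2′-S UV) ↦ (E2′-S2 UV):
(E0) ∧ (E1-v4) ∧ (E2-v7) ∧ (E2″-v6) ∧ (E2′-S3) ∧ (E2′-S2 UV) ∧ (E4) ∧ (E5-S).  Same slot type as `Preds.engine`. -/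
def EngineBoundsAtV7S (G : GeoConsts) (P : SplitConsts) (Q : EngConsts) (β U μ : ℝ) (K : TrigPolyC4v) (n : ℕ) : Prop :=
  SelfEnergySymmetric L M β U μ K n ∧ KernelNormsV4 L M P Q β U μ K n ∧
    PairLadderStepAtV7 L M G P Q β U μ K n ∧ PairValueIncrementAtV6 L M G P Q β U μ K n ∧
      QuarticValueIncrementAtS3 L M G P Q β U μ K n ∧ QuarticValueUVAtS2 L M G P Q β U μ K n ∧
        EngineFirstMoments L M G P Q β U μ K n ∧ IsoTupleL1AtS L M G P β U μ K n

/-! ## §2 The V10 history, two-leg slot and bundle -/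

/-- **The comparison-frame / comparison-volume history of the V10 bundle** at scale `j`: `BetaSplitAtS2 ∧ RenormalisedAtF ∧ EngineBoundsAtV7S`. -/
def histV10 (G : GeoConsts) (P : SplitConsts) (Q : EngConsts) (R : RenConsts) (β U μ : ℝ) : TrigPolyC4v → ℕ → Prop :=
  fun K' j => BetaSplitAtS2 L M G P Q β U μ K' j ∧ RenormalisedAtF L M β U μ K' R j ∧ EngineBoundsAtV7S L M G P Q β U μ K' j

/-- **`TwoLegStepV10 … G P Q R K n`** := `TwoLegStepG histV10 ∧ TwoLegAngularG ∧ TwoLegVolumeRate (histV10 ∧ TwoLegStepG histV10 ∧ TwoLegAngularG)`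
— V9's two-leg slot (with (E3g)) read at the V10 history.  Same slot type as `Preds.twoLeg`. -/
def TwoLegStepV10 (G : GeoConsts) (P : SplitConsts) (Q : EngConsts) (R : RenConsts) (β U μ : ℝ) (K : TrigPolyC4v) (n : ℕ) :
    Prop :=
  TwoLegStepG L M (histV10 L M G P Q R β U μ) G P Q R β U μ K n ∧ TwoLegAngularG L M G Q R β U μ K n ∧
    TwoLegVolumeRate L M
      (fun L' M' _ _ K' j => histV10 L' M' G P Q R β U μ K' j ∧
        TwoLegStepG L' M' (histV10 L' M' G P Q R β U μ) G P Q R β U μ K' j ∧ TwoLegAngularG L' M' G Q R β U μ K' j)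
      Q β U μ K n

end Model

/-- **`klPredsV10 : Preds`** := `{ frameOK := FrameOK, renorm := RenormalisedAtF, split := BetaSplitAtS2, engine := EngineBoundsAtV7S,
twoLeg := TwoLegStepV10 }`.  Children: `EngineP4 | BetaSplitP | CountertermP2 | VolumeLimitP2 (FinalTwoLegVolLimit) | TwoPointAssemblyP3
(FinalTwoLegVolLimit)` on `klPredsV10 klWindowC`. -/
def klPredsV10 : Preds where
  frameOK := FrameOK
  renorm := fun L M _ _ β U μ K R n => RenormalisedAtF L M β U μ K R n
  split := fun L M _ _ G P Q β U μ K n => BetaSplitAtS2 L M G P Q β U μ K n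
  engine := fun L M _ _ G P Q β U μ K n => EngineBoundsAtV7S L M G P Q β U μ K n
  twoLeg := fun L M _ _ G P Q R β U μ K n => TwoLegStepV10 L M G P Q R β U μ K n

/-! ## §3 Bookkeeping (`rfl`-level) -/

/-- V10's frame class IS V9's (`FrameOK`). -/
theorem klPredsV10_frameOK : klPredsV10.frameOK = klPredsV9.frameOK := rfl

/-- V10's renormalisation slot IS V9's (`RenormalisedAtF`). -/
theorem klPredsV10_renorm : klPredsV10.renorm = klPredsV9.renorm := rfl

/-- V10's split slot IS V9's (`BetaSplitAtS2` — child 1's slot is untouched by Δ-UV). -/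
theorem klPredsV10_split : klPredsV10.split = klPredsV9.split := rfl

/-- V10's split slot is `BetaSplitAtS2`. -/
theorem klPredsV10_split_apply (L M : ℕ) [NeZero L] [NeZero M] (G : GeoConsts) (P : SplitConsts) (Q : EngConsts) (β U μ : ℝ)
    (K : TrigPolyC4v) (n : ℕ) : klPredsV10.split L M G P Q β U μ K n = BetaSplitAtS2 L M G P Q β U μ K n := rfl

/-- V10's engine slot is `EngineBoundsAtV7S`. -/
theorem klPredsV10_engine (L M : ℕ) [NeZero L] [NeZero M] (G : GeoConsts) (P : SplitConsts) (Q : EngConsts) (β U μ : ℝ)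
    (K : TrigPolyC4v) (n : ℕ) : klPredsV10.engine L M G P Q β U μ K n = EngineBoundsAtV7S L M G P Q β U μ K n := rfl

/-- V10's two-leg slot is `TwoLegStepV10`. -/
theorem klPredsV10_twoLeg (L M : ℕ) [NeZero L] [NeZero M] (G : GeoConsts) (P : SplitConsts) (Q : EngConsts) (R : RenConsts)
    (β U μ : ℝ) (K : TrigPolyC4v) (n : ℕ) :
    klPredsV10.twoLeg L M G P Q R β U μ K n = TwoLegStepV10 L M G P Q R β U μ K n := rfl

section Model

variable {L M : ℕ} [NeZero L] [NeZero M] {G : GeoConsts} {P : SplitConsts} {Q : EngConsts} {R : RenConsts} {β U μ : ℝ}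
  {K : TrigPolyC4v} {n : ℕ}

/-- `HistP klPredsV10` below `n` yields `histV10 … K j` for every `j < n`. -/
theorem histV10_of_histP (h : HistP klPredsV10 L M G P Q R β U μ K n) : ∀ j < n, histV10 L M G P Q R β U μ K j :=
  fun j hj => ⟨(h j hj).1, (h j hj).2.1, (h j hj).2.2.1⟩

/-- The «G» two-leg step is the first conjunct of the V10 two-leg slot. -/
theorem twoLegStepG_of_twoLegStepV10 (h : TwoLegStepV10 L M G P Q R β U μ K n) :
    TwoLegStepG L M (histV10 L M G P Q R β U μ) G P Q R β U μ K n := h.1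

/-- (E3g) is the second conjunct of the V10 two-leg slot. -/
theorem twoLegAngularG_of_twoLegStepV10 (h : TwoLegStepV10 L M G P Q R β U μ K n) :
    TwoLegAngularG L M G Q R β U μ K n := h.2.1

/-- k3c3-p3's packaging at V10: `TwoLegStepGA histV10`. -/
theorem twoLegStepGA_of_twoLegStepV10 (h : TwoLegStepV10 L M G P Q R β U μ K n) :
    TwoLegStepGA L M (histV10 L M G P Q R β U μ) G P Q R β U μ K n := ⟨h.1, h.2.1⟩

/-- `HistP klPredsV10` below `n` yields the full (E3f) antecedent of V10 at that volume. -/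
theorem histRateV10_of_histP (h : HistP klPredsV10 L M G P Q R β U μ K n) :
    ∀ j < n, histV10 L M G P Q R β U μ K j ∧ TwoLegStepG L M (histV10 L M G P Q R β U μ) G P Q R β U μ K j ∧
      TwoLegAngularG L M G Q R β U μ K j := fun j hj =>
  ⟨⟨(h j hj).1, (h j hj).2.1, (h j hj).2.2.1⟩, (h j hj).2.2.2.1, (h j hj).2.2.2.2.1⟩

/-- **V10's rate clause applies whenever the comparison volume carries the V10 history** (child 2's one-liner). -/
theorem twoLegVolumeRate_apply_of_V10 (h : TwoLegStepV10 L M G P Q R β U μ K n) (hM : Q.M0 β L ≤ M) {L' M' : ℕ} [NeZero L']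
    [NeZero M'] (hL : L ≤ L') (hM' : Q.M0 β L' ≤ M') (hhist : HistP klPredsV10 L' M' G P Q R β U μ K n) (θ : ℝ) :
    |klLocalPart L M β U μ K n θ - klLocalPart L' M' β U μ K n θ| ≤ Q.CL β n / L :=
  h.2.2 hM L' M' hL hM' (histRateV10_of_histP hhist) θ

end Model

/-! ## §4 Scale `0`: the repaired clauses are WEAKER than the born ones (one-way) -/

section ScaleZero

variable (L M : ℕ) [NeZero L] [NeZero M]

/-- The born (E2-v6) implies (E2-v7) when `Q.CR, Klam ≥ 0` (the scale-`0` tolerance only grows; the `1 ≤ n` conjuncts coincide). -/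
theorem pairLadderStepAtV7_of_V6 {G : GeoConsts} {P : SplitConsts} {Q : EngConsts} (hK : 0 ≤ P.Klam) (hQ : 0 ≤ Q.CR) {β U μ : ℝ}
    {K : TrigPolyC4v} {n : ℕ} (h : PairLadderStepAtV6 L M G P Q β U μ K n) : PairLadderStepAtV7 L M G P Q β U μ K n := by
  refine ⟨fun hn Qm k hk k' hk' => (h.1 hn Qm k hk k' hk').trans ?_, h.2⟩
  have := legDressBarQ_nonneg G hK hQ U 0 4
  linarith

/-- The born (E2′-S UV) implies (E2′-S2 UV) when `Q.CR, Klam ≥ 0`. -/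
theorem quarticValueUVAtS2_of_S {G : GeoConsts} {P : SplitConsts} {Q : EngConsts} (hK : 0 ≤ P.Klam) (hQ : 0 ≤ Q.CR) {β U μ : ℝ}
    {K : TrigPolyC4v} {n : ℕ} (h : QuarticValueUVAtS L M G β U μ K n) : QuarticValueUVAtS2 L M G P Q β U μ K n := by
  intro hn k₁ hk₁ k₂ hk₂ k₃ hk₃
  have := legDressBarQ_nonneg G hK hQ U 0 4
  exact (h hn k₁ hk₁ k₂ hk₂ k₃ hk₃).trans (by linarith)

/-- **`EngineBoundsAtV6S … n → EngineBoundsAtV7S … n`** for `Q.CR, Klam ≥ 0` (every scale; in particular the scale-`0` rung stated at V6S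
yields the V7S one — the converse fails: Δ-UV). -/
theorem engineBoundsAtV7S_of_V6S {G : GeoConsts} {P : SplitConsts} {Q : EngConsts} (hK : 0 ≤ P.Klam) (hQ : 0 ≤ Q.CR) {β U μ : ℝ}
    {K : TrigPolyC4v} {n : ℕ} (h : EngineBoundsAtV6S L M G P Q β U μ K n) : EngineBoundsAtV7S L M G P Q β U μ K n :=
  ⟨h.1, h.2.1, pairLadderStepAtV7_of_V6 L M hK hQ h.2.2.1, h.2.2.2.1, h.2.2.2.2.1,
    quarticValueUVAtS2_of_S L M hK hQ h.2.2.2.2.2.1, h.2.2.2.2.2.2.1, h.2.2.2.2.2.2.2⟩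

/-- **At the inductive scales the two engine slots COINCIDE**: for `1 ≤ n`, `EngineBoundsAtV7S … n ↔ EngineBoundsAtV6S … n` (the repaired
clauses differ from the born ones only in their `n = 0` conjuncts, which are vacuous at `n ≥ 1`) — the `stub_engine_step*` statements are
untouched in content by Δ-UV. -/
theorem engineBoundsAtV7S_iff_V6S_of_pos (G : GeoConsts) (P : SplitConsts) (Q : EngConsts) (β U μ : ℝ) (K : TrigPolyC4v) {n : ℕ}
    (hn : 1 ≤ n) : EngineBoundsAtV7S L M G P Q β U μ K n ↔ EngineBoundsAtV6S L M G P Q β U μ K n := by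
  have hn0 : n ≠ 0 := by omega
  have h1 : PairLadderStepAtV7 L M G P Q β U μ K n ↔ PairLadderStepAtV6 L M G P Q β U μ K n := by
    simp only [PairLadderStepAtV7, PairLadderStepAtV6, hn0, IsEmpty.forall_iff, true_and]
  have h2 : QuarticValueUVAtS2 L M G P Q β U μ K n ↔ QuarticValueUVAtS L M G β U μ K n := by
    simp only [QuarticValueUVAtS2, QuarticValueUVAtS, hn0, IsEmpty.forall_iff]
  unfold EngineBoundsAtV7S EngineBoundsAtV6S
  rw [h1, h2]

end ScaleZero

end Summit.HubbardSuperconductivity.HubbardSuperconductivity.Theorems.KLRegimeSplit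

end
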